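import Summits.QuantumFields.Balaban3D.Carriers.Standard
import Summits.QuantumFields.Balaban3D.Proofs.EndTheorem
import Summits.QuantumFields.Balaban3D.Proofs.StarCountRun3
import Summits.QuantumFields.Balaban3D.Proofs.Step0Tower
import Summits.QuantumFields.Balaban3D.Proofs.Run3Zterm
import Summits.QuantumFields.Balaban3D.Proofs.VacuumAndBooking

/-!
# Bałaban CMP 102 (1985), d = 3 lane — `Proofs.Inputs`: THE LANE'S v1 TOWER INPUT `Carriers.towerInputOf X K 𝔖 C` (PLAN §0.5 E4
# pointer, lead batch 13 (a)) with the carrier constants `K`, the step-piece parameters `C` and the step-leaf constants DEFINED from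
# ONE constants record per group; the carrier bookkeeping (`UsesConsts`, the unit configuration (R1)) and the bookkeeping step
# leaves (`starCount`, `ztermSucc`, `rmSucc`) DISCHARGED at the lane's pieces

Source: T. Bałaban, *Ultraviolet stability of three-dimensional lattice pure gauge field theories*, Commun. Math. Phys. **102** (1985)
255–275 [Balaban1985UV3] ([B10]; PDF page = journal page − 254).  Lane `pub-balaban3d`, seat p3 (PLAN §0.5 E4 / §4 STEP-5; rulings
R-FL′ (the only free tower fields are print's external inputs `ExternalInputs` and the expansion data `StepSeries`), R-COL, R-MASS,
R-CONST, R-NORM, R-E, R-EPS0′, R-END″; LEAF-LEDGER §B/§C/§F).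

ARCHITECTURE (what is quantified, what is defined).  For every group as printed `(G, 𝔊)` the END THEOREM quantifies over
* a constants record `𝔎 : LaneConsts L` (the family parameters `κ₀, M₁, b₀, p₀, r₀, R₁` of (7) p. 257 / p. 262, the group constants
  `log σ₀` (18) p. 260 and `d(𝔤)` (22) p. 261, and the O(1)'s of the leaves — R-CONST: ONE profile for every step and every lattice
  approximation), and a threshold `γ₀ > 0` («ε₀ … depending on the coupling constant g only», p. 256 L15–18, R-EPS0′);
* for every lattice approximation `S : Scales L`: print's EXTERNAL INPUTS `X : Carriers.ExternalInputs S G` (the averaging `Ū` of [4]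
  with its absolute-continuity certificate, the minimizers of [7] Thm 1 / (42), the R-RN barriers) and the EXPANSION DATA
  `𝔖 k : Carriers.StepSeries S G k` of every step (R-FL);
and DEFINES from them (nothing else is free): the carrier constants `𝔎.carrier : Carriers.CarrierConsts` (so `Rcol`, `ε₁`, the
`|Z_j|`- and remainder-coefficient profiles of (41) and the masses are p1's DEFINITIONS `rcolOf`, `eps1Of`, `zcoefOf`, `rcoefOf`,
`histWeights3`), the step-piece parameters `Carriers.piecesParamsOf S 𝔎.carrier k` (p1: `|T₁^{(k)*}| := B10StarCount.starCount univ`,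
`|B(Λ_{k+1}(h))*| := starCount (Λ_{k+1}(h))` on p1's regions (`Carriers.LamFin`), `log σ₀`, `d(𝔤)`, the remainder unit `(g_k²)^{3+κ₀}|T₁^{(k)}|`), the
tower input `inputOf 𝔎 X 𝔖 := Carriers.stdTowerInput X 𝔎.carrier 𝔖` (= `towerInputOf X 𝔎.carrier 𝔖 (piecesParamsOf S 𝔎.carrier)`, p1 v1.2), its tower `(inputOf …).towerWith ⊤` /
`tower3` (p1), and the step pieces `pieces 𝔎 X 𝔖 k := Carriers.seriesPieces …` (p1's `seriesPieces`: the eleven analytic pieces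
DEFINED from `𝔖 k`, R-FL (ii)).
WHAT THIS FILE DISCHARGES (kernel bookkeeping, standard axioms), as fields of `UVStability3D.AnalyticLeaves 𝔎.consts S (towerOf 𝔎 X 𝔖)`:
`step0` ((1) p. 256 at k = 0: seat p4's `Step0Tower.step0_pin`, its three hypotheses `rfl`/p1's `lf_zero` here), `noInt0` (p1
`noInteraction0_series`), and inside every `StepLeaves`: `pintSucc` ((36)/(41), p1 `pintSucc_series`, rfl), `estep62` ((62), p1
`estep62_series`, rfl), `starCount` (the unprinted count behind p. 265 L8–9 / p. 271 L13 with `c₁ = 3`: `StarCountRun3.starCount_leaf_run3`),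
`ztermSucc` (the Z-term booking of (41): seat p5's `Run3Zterm.ztermSucc_towerObjects` with p1's `tower3_Zvol_proj`; the booked
coefficient `zcoefOf` IS the gathered constant), `rmSucc` (the remainder booking of (41): seat p6's `VacuumAndBooking.rmSucc_of_sum_booking`;
`rcoefOf k·(L^kε)^{3+κ₀}|T₁^{(k)}| = rstar·(g_k²)^{3+κ₀}|T₁^{(k)}|` by `ScalesArithmetic.gk_sq_rpow`), the piece equations `starT_eq`,
`rem_eq` (`rfl`) and bounds `logσ₀_le`, `dg_le` (`le_rfl`: `σmax := |log σ₀|`, `dg := d(𝔤)`), and `UsesConsts` (M₁, b₀, p₀, κ₀ by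
`rfl`, `rcoefOf = rstar·(g²)^{3+κ₀}` by `Real.rpow_natCast_mul`).
WHAT REMAINS is bundled in the sibling `Proofs.Residuals` (`StepResiduals`/`RunResiduals`: the nine analytic step leaves per k < K
and the four run-level leaves, each a LEAF-LEDGER row owned by a leaf seat, stated as the LQB leaf AT THE LANE'S PIECES), which also
holds the END THEOREMS `uvStability3D_of_residuals` / `not_literal_of_residuals` at `mkT`.
HONEST FRAMING (PLAN §0): UV stability of the d = 3 lattice theory on a finite torus, as printed — NOT a continuum limit, NOT
infinite volume, NOT a mass gap, NOT d = 4, nothing about the Millennium problem; the residual leaves are hypotheses, the expansion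
data are data; nothing of the paper is asserted.  No `sorry`, no new axiom.
-/

noncomputable section

namespace Summit.QuantumFields.Balaban3D.Proofs.Inputs

open Literature.MathematicalPhysics.QuantumFieldTheory.Balaban1983to89
open Literature.MathematicalPhysics.QuantumFieldTheory.Balaban1983to89.B10
open Literature.MathematicalPhysics.QuantumFieldTheory.Balaban1983to89.B10SectAGathering
open Literature.MathematicalPhysics.QuantumFieldTheory.Balaban1985CMP102
open Literature.MathematicalPhysics.QuantumFieldTheory.Balaban1985CMP102.Setting
open Literature.MathematicalPhysics.QuantumFieldTheory.Balaban1985CMP102.Theorems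
open Literature.MathematicalPhysics.QuantumFieldTheory.Balaban1985CMP102.SectB
open Summit.QuantumFields.Balaban3D.Carriers
open Summit.QuantumFields.Balaban3D.Proofs.ScalesArithmetic
open Summit.QuantumFields.Balaban3D.Proofs.Constants
open Summit.QuantumFields.Balaban3D.Proofs.UVStability3D
open Summit.QuantumFields.Balaban3D.Proofs.NegativeEdge
open Summit.QuantumFields.Balaban3D.Proofs.EndTheorem
open Summit.QuantumFields.Balaban3D.Proofs.StarCountRun3

variable {L : ℕ}

/-! ## §1 ONE constants record per group; the carrier constants, step-piece parameters and step-leaf constants DEFINED from it -/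

/-- **THE LANE'S CONSTANTS RECORD** (R-CONST; one per group as printed): the family parameters and run-level O(1)'s
(`Constants.FamilyConsts`: `κ₀, M₁, b₀, p₀, r₀, R₁` of (7) p. 257 / p. 262, `C46` of (46), `z, aP` of (65), `log σ₀` of (18), `d(𝔤)`
of (22)) and the step O(1)'s (`Constants.StepConsts`: `Cz, C₁, C₁', C₂, Cv, C₃, C₄, C₅, C₆`).  Names only. [cite: Balaban1985UV3, (7) p.257 + (41) p.266 + (62) p.271] -/
structure LaneConsts (L : ℕ) where
  /-- family parameters and run-level constants -/
  F : FamilyConsts L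
  /-- step constants -/
  sc : StepConsts

namespace LaneConsts

variable (𝔎 : LaneConsts L)

/-- The normalised `B10Assembly.Consts` of the record (`Constants.consts3`: `g := 1`, `d := 6/log L`, `rstar := max C₁ C₁' + C₂ + C₃ + C₄`,
`σmax := |log σ₀|`, `dg := d(𝔤)`). [cite: Balaban1985UV3, p.256 + p.257] -/
def consts : B10Assembly.Consts := consts3 𝔎.F 𝔎.sc

/-- `𝔎.consts` is normalised (`g = 1`, `L = L`). [folklore] -/
theorem normalised : NormalisedConsts L 𝔎.consts := normalisedConsts_consts3 _ _

/-- **THE CARRIER CONSTANTS** p1's definitions consume (`Carriers.CarrierConsts`, R-FL′): `M₁, R₁, r₀, b₀, p₀, κ₀` of the family, the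
Z-term constants `Cz, Cv, C₅, C₆` of the step profile, the star-count deficit `c₁ := 3` (`Constants.starCount_leaf_three`), the group
constants `log σ₀, d(𝔤)`, and the remainder constant `CR := rstar = max C₁ C₁' + C₂ + C₃ + C₄` — so that the booked profiles
`zcoefOf`/`rcoefOf` of (41) ARE the gathered constants of `B10SectAGathering.StepLeaves.ztermSucc`/`.rmSucc`. [cite: Balaban1985UV3, (7) p.257 + (39)–(41) p.266] -/
def carrier : CarrierConsts where
  M₁ := 𝔎.F.M₁
  R₁ := 𝔎.F.R₁
  r₀ := 𝔎.F.r₀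
  b₀ := 𝔎.F.b₀
  p₀ := 𝔎.F.p₀
  κ₀ := 𝔎.F.κ₀
  Cz := 𝔎.sc.Cz
  Cv := 𝔎.sc.Cv
  C₅ := 𝔎.sc.C₅
  C₆ := 𝔎.sc.C₆
  c₁ := 3
  logσ₀ := 𝔎.F.logσ₀
  dg := 𝔎.F.dimg
  dg_nonneg := Nat.cast_nonneg _
  CR := 𝔎.sc.rstar

end LaneConsts

/-- A CHART-VALUE SPACE (p1 v1.3, ruling R-32′): the complex normed space `V` in which the chart configurations `𝓗 : bonds → V` of (27)/(29)
take values (print: the complexified Lie algebra `𝔤ᶜ`; the lead's end-theorem choice is `V := 𝔤ᶜ` of the group model), bundled with its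
instances so that it can be chosen per group; finite-dimensional (the representation leaves' Taylor remainders, p6). [cite: Balaban1985UV3, (27)–(29) p.263] -/
structure ChartSpace : Type 1 where
  /-- the carrier -/
  V : Type
  /-- its normed group structure -/
  [instV₁ : NormedAddCommGroup V]
  /-- its complex normed space structure -/
  [instV₂ : NormedSpace ℂ V]
  /-- finite-dimensionality -/
  [instV₃ : FiniteDimensional ℂ V]

/-- The normed group structure of a chart-value space (the record's field `instV₁` as a declared instance — same term as registering the
projection). [folklore] -/
instance ChartSpace.instNormedAddCommGroupV (W : ChartSpace) : NormedAddCommGroup W.V := W.instV₁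

/-- The complex normed space structure of a chart-value space (field `instV₂`). [folklore] -/
instance ChartSpace.instNormedSpaceV (W : ChartSpace) : NormedSpace ℂ W.V := W.instV₂

/-- Finite-dimensionality of a chart-value space (field `instV₃`). [folklore] -/
instance ChartSpace.instFiniteDimensionalV (W : ChartSpace) : FiniteDimensional ℂ W.V := W.instV₃

/-! The STEP-PIECE PARAMETERS of step `k → k+1` are p1's `Carriers.piecesParamsOf S 𝔎.carrier k` (R-PIECES (a)–(c), v1.1):
`|B(Λ_{k+1}(h))*| := starCount (Λ_{k+1}(h))` with «Λ_{k+1} = Ω_{k+1}^{(k+1)}» on p1's regions (`Carriers.LamFin`, p. 268), `|T₁^{(k)*}| :=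
starCount univ` (the concrete d = 3 count of p. 260, `B10StarCount`), `log σ₀`, `d(𝔤) ≥ 0` of the group, and the remainder unit
`(g_k²)^{3+κ₀}|T₁^{(k)}|` of (41)/(58) in g_k-units (R-NORM, p. 269 L24). -/

section Defs

variable (𝔎 : LaneConsts L) {S : Scales L} {G : Type} [GaugeGroup G] [MeasurableSpace G] [HaarData G]
  {V : Type} [NormedAddCommGroup V] [NormedSpace ℂ V]
  (X : ExternalInputs S G) (𝔖 : ∀ k, StepSeries S G V (nblkOf S 𝔎.carrier k) k)

/-- **THE LANE'S TOWER INPUT** (PLAN §0.5 E4 pointer, batch 13 (a)): p1's standard tower input `stdTowerInput X K 𝔖 = towerInputOf X K 𝔖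
(piecesParamsOf S K)` (v1.2) at the record's carrier constants `K := 𝔎.carrier` — `W := histWeights3` (R-MASS), `Rcol := ⌈R₁r(g_k)⌉M₁`
(R-COL), `ε₁ := g_kp(g_k)`, `zcoef := zcoefOf`, `rcoef := rcoefOf`, retained radius `rretOf`, block counts `nblkOf` (R-OMEGA), `Pint`/`E^{(k)}`
and the R-RN barriers from the series (R-FL, v1.2/v1.3); chart values in `V` (R-32′). [cite: Balaban1985UV3, (38)–(43) p.266 + (62) p.271] -/
def inputOf : TowerInput S G := stdTowerInput X 𝔎.carrier 𝔖

/-- `inputOf` is `towerInputOf` at `piecesParamsOf` (definitional; p1 `stdTowerInput_eq`). [folklore] -/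
theorem inputOf_eq : inputOf 𝔎 X 𝔖 = towerInputOf X 𝔎.carrier 𝔖 (piecesParamsOf S 𝔎.carrier) := rfl

/-- The pinned tower of the lane's input (`tower3 = (towerWith ⊤).pin`, p1) as a `B10.TowerRun`. [folklore] -/
abbrev towerOf : TowerRun := (inputOf 𝔎 X 𝔖).tower3.toTowerRun

/-- **THE STEP PIECES of the lane** at step `k`: p1's `seriesPieces` (the eleven analytic pieces DEFINED from `𝔖 k`, R-FL (ii)) over
the tower of `inputOf`. [cite: Balaban1985UV3, (55)–(63) pp.269–272] -/
abbrev pieces (k : ℕ) : StepPieces (towerOf 𝔎 X 𝔖) k :=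
  seriesPieces (X.toTowerBase 𝔎.carrier) 𝔖 (piecesParamsOf S 𝔎.carrier) k

end Defs

/-- **THE LANE'S TOWER CONSTRUCTION** (PLAN §0.5 E4: `mkT := fun G 𝔊 S => towerWith (towerInputOf (X G 𝔊 S) K (𝔖 G 𝔊 S) (C G 𝔊 S)) ⊤`
with `K`, `C` DEFINED from the group's constants record). [cite: Balaban1985UV3, (38)–(43) p.266] -/
def mkT (𝔎 : ∀ (G : Type) [GaugeGroup G] [MeasurableSpace G] [HaarData G], GroupModel G → LaneConsts L)
    (𝒱 : ∀ (G : Type) [GaugeGroup G] [MeasurableSpace G] [HaarData G], GroupModel G → ChartSpace)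
    (X : ∀ (G : Type) [GaugeGroup G] [MeasurableSpace G] [HaarData G], GroupModel G → ∀ S : Scales L, ExternalInputs S G)
    (𝔖 : ∀ (G : Type) [GaugeGroup G] [MeasurableSpace G] [HaarData G] (𝔊 : GroupModel G) (S : Scales L) (k : ℕ),
      StepSeries S G (𝒱 G 𝔊).V (nblkOf S (𝔎 G 𝔊).carrier k) k) :
    TowerConstruction L :=
  fun G _ _ _ 𝔊 S => (inputOf (𝔎 G 𝔊) (X G 𝔊 S) (𝔖 G 𝔊 S)).towerWith fun _ => True

/-! ## §2 The carrier bookkeeping: `UsesConsts`, (R1) the unit configuration -/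

section Carrier

variable (𝔎 : LaneConsts L) {S : Scales L} {G : Type} [GaugeGroup G] [MeasurableSpace G] [HaarData G]
  {V : Type} [NormedAddCommGroup V] [NormedSpace ℂ V]
  (X : ExternalInputs S G) (𝔖 : ∀ k, StepSeries S G V (nblkOf S 𝔎.carrier k) k)

/-- `(g²)^{3+κ} = g^{6+2κ}` for the (positive) coupling: the two spellings of the remainder coefficient (p1's `rcoefOf`: `CR·g^{6+2κ₀}`;
`EndTheorem.UsesConsts`: `rstar·(g²)^{3+κ₀}`). [folklore] -/
theorem sq_rpow_three_add (S : Scales L) (κ : ℝ) : (S.g ^ 2) ^ (3 + κ) = S.g ^ ((6 : ℝ) + 2 * κ) := by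
  rw [show (S.g ^ 2 : ℝ) = S.g ^ (2 : ℕ) from rfl, ← Real.rpow_natCast_mul S.g_pos.le]
  norm_num
  ring_nf

/-- p1's remainder-coefficient profile at the record's carrier constants IS `rstar·(g²)^{3+κ₀}`. [cite: Balaban1985UV3, (41) p.266] -/
theorem rcoefOf_carrier (S : Scales L) (j : ℕ) :
    rcoefOf S 𝔎.carrier j = 𝔎.consts.rstar * (S.g ^ 2) ^ (3 + 𝔎.consts.κ₀) := by
  show 𝔎.sc.rstar * S.g ^ ((6 : ℝ) + 2 * 𝔎.F.κ₀) = 𝔎.sc.rstar * (S.g ^ 2) ^ (3 + 𝔎.F.κ₀)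
  rw [sq_rpow_three_add]

/-- **p1's tower over ANY input USES the family constants** as soon as the input takes `M₁, b₀, p₀, κ₀` from them and books
`rcoef j = rstar·(g²)^{3+κ₀}`; `|Λ_k| = min(Λ-count, |T₁^{(k)}|) ≥ 0` by construction. [cite: Balaban1985UV3, (7) p.257 + (41) p.266] -/
theorem usesConsts_towerWith (D : TowerInput S G) (slot : ℕ → Prop) {C : B10Assembly.Consts}
    (hM : (D.M₁ : ℝ) = C.M₁) (hb : D.b₀ = C.b₀) (hp : D.p₀ = C.p₀) (hκ : D.κ₀ = C.κ₀)
    (hr : ∀ j, D.rcoef j = C.rstar * (S.g ^ 2) ^ (3 + C.κ₀)) :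
    UsesConsts C (D.towerWith slot) where
  M₁_eq := hM
  b₀_eq := hb
  p₀_eq := hp
  κ₀_eq := hκ
  rcoef_eq := hr
  Λvol_nonneg k _ := le_min (Nat.cast_nonneg _) (ScalesArithmetic.sites_nonneg S k)

/-- **THE LANE'S TOWER USES THE RECORD'S CONSTANTS** (`EndTheorem.UsesConsts`): `M₁, b₀, p₀, κ₀` by `rfl`, the remainder profile by
`rcoefOf_carrier`. [cite: Balaban1985UV3, (7) p.257 + (41) p.266] -/
theorem usesConsts_inputOf (slot : ℕ → Prop) : UsesConsts 𝔎.consts ((inputOf 𝔎 X 𝔖).towerWith slot) :=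
  usesConsts_towerWith (inputOf 𝔎 X 𝔖) slot rfl rfl rfl rfl (fun j => rcoefOf_carrier 𝔎 S j)

/-- **(R1) FOR TOWER OBJECTS WITH `U₀ = id` AND `ε₁(0) > 0`**: the unit configuration `U ≡ 1` is a level-0 configuration with
`A(U₀(1)) = A(1) = Σ_p η⁻¹[1 − Re tr 1] = 0` and `χ₀(1) = 1` (`|1 − 1| = 0 < ε₁(0)`), i.e. reader's item `B10DagLeaf.UnitConfig0` of
the negative edge HOLDS for the spine's tower objects (R-K0). [cite: Balaban1985UV3, (1) + (4) + (5) p.256] -/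
theorem unitConfig0_towerObjects (W : TowerObjects S G) (hU0 : ∀ V : GaugeField S.P 0 G, W.Uk 0 V = V) (hε : 0 < W.ε₁ 0) :
    B10DagLeaf.UnitConfig0 W.toTowerRun := by
  -- the plaquette variables of the unit configuration are `1` (LQB `B15Chi124DetSets.plaqHol_one`, inlined — R-DEDUP)
  have plaqHol_unit : ∀ p : Plaq S.P 0, GaugeField.plaqHol (1 : GaugeField S.P 0 G) p = 1 := fun p => by
    show (1 : G) * 1 * (1 : G)⁻¹ * (1 : G)⁻¹ = 1
    simp
  refine ⟨(1 : GaugeField S.P 0 G), ?_, ?_⟩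
  · -- A^η(U₀(1)) = Σ_p η⁻¹[1 − Re tr 1] = 0
    show S.actionEta 0 (W.Uk 0 1) = 0
    rw [hU0]
    show wilsonAction (S.eta 0)⁻¹ (1 : GaugeField S.P 0 G) = 0
    unfold wilsonAction
    refine Finset.sum_eq_zero fun p _ => ?_
    rw [plaqHol_unit, GaugeGroup.reTr_one, sub_self, mul_zero]
  · -- χ₀(1) = 1: every plaquette variable is within ε₁ 0 of 1
    show chiSmall Set.univ (W.ε₁ 0) (1 : GaugeField S.P 0 G) = 1
    unfold chiSmall
    rw [if_pos]
    intro p _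
    rw [plaqHol_unit, GaugeGroup.dist1_one]
    exact hε

/-- `ε₁(k) = g_k·p(g_k) > 0` for the lane's input, `k ≤ K` (`eps1Of`; `p(g) = b₀(1 + log g⁻¹)^{p₀} > 0` for `b₀ > 0`, `0 < g_k ≤ 1`).
[cite: Balaban1985UV3, (7) p.257] -/
theorem eps1_inputOf_pos (k : ℕ) (hk : k ≤ S.K) : 0 < (inputOf 𝔎 X 𝔖).ε₁ k := by
  show 0 < S.gk k * pFun 𝔎.F.b₀ 𝔎.F.p₀ (S.gk k)
  have hu : 0 < 1 + Real.log (S.gk k)⁻¹ := by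
    have := log_inv_nonneg_of_le_one (gk_pos S k) (gk_le_one S S.gK_le_one k hk); linarith
  exact mul_pos (gk_pos S k) (mul_pos 𝔎.F.b₀_pos (Real.rpow_pos_of_pos hu _))

/-- **(R1) for the lane's (pinned) tower**: `U₀ = id` (p1's `ukAll`, R-K0) and `ε₁(0) > 0`. [cite: Balaban1985UV3, (1) + (4) p.256] -/
theorem unitConfig0_inputOf : B10DagLeaf.UnitConfig0 (towerOf 𝔎 X 𝔖) :=
  unitConfig0_towerObjects (inputOf 𝔎 X 𝔖).tower3
    (fun V => by
      show (run3 ((inputOf 𝔎 X 𝔖).toRunInput fun _ => True)).Uk 0 V = V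
      rw [TowerInput.ukAll_eq]; rfl)
    (eps1_inputOf_pos 𝔎 X 𝔖 0 (Nat.zero_le _))

end Carrier

/-! ## §2b The unpinned tower objects and pieces (the shape of seat p4's `Bound55Tower` theorems) and the transfer to the pinned ones -/

section Unpin

variable (𝔎 : LaneConsts L) {S : Scales L} {G : Type} [GaugeGroup G] [MeasurableSpace G] [HaarData G]
  {V : Type} [NormedAddCommGroup V] [NormedSpace ℂ V]
  (X : ExternalInputs S G) (𝔖 : ∀ k, StepSeries S G V (nblkOf S 𝔎.carrier k) k)

/-- The lane's stage-1 tower objects `towerWith ⊤` (unpinned; `mkT G 𝔊 S` is this, `towerOf` is its `pin`). [folklore] -/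
abbrev towerW : TowerObjects S G := (inputOf 𝔎 X 𝔖).towerWith fun _ => True

/-- The lane's step pieces read over the UNPINNED tower `towerW` (same fields; the shape of seat p4's `Bound55Tower.bound55_of_select`,
which is stated for `StepPieces (D.towerWith slot).toTowerRun k`). [folklore] -/
def piecesW (k : ℕ) : StepPieces (towerW 𝔎 X 𝔖).toTowerRun k where
  proj := (pieces 𝔎 X 𝔖 k).proj
  proj_triv := (pieces 𝔎 X 𝔖 k).proj_triv
  Zvol := (pieces 𝔎 X 𝔖 k).Zvol
  Zvol_nonneg := (pieces 𝔎 X 𝔖 k).Zvol_nonneg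
  Zvol_triv := (pieces 𝔎 X 𝔖 k).Zvol_triv
  starB := (pieces 𝔎 X 𝔖 k).starB
  starT := (pieces 𝔎 X 𝔖 k).starT
  logσ₀ := (pieces 𝔎 X 𝔖 k).logσ₀
  dg := (pieces 𝔎 X 𝔖 k).dg
  dg_nonneg := (pieces 𝔎 X 𝔖 k).dg_nonneg
  logZU := (pieces 𝔎 X 𝔖 k).logZU
  logZ1 := (pieces 𝔎 X 𝔖 k).logZ1
  logZT := (pieces 𝔎 X 𝔖 k).logZT
  logFl := (pieces 𝔎 X 𝔖 k).logFl
  PprU := (pieces 𝔎 X 𝔖 k).PprU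
  Ppr1 := (pieces 𝔎 X 𝔖 k).Ppr1
  PprT := (pieces 𝔎 X 𝔖 k).PprT
  PY := (pieces 𝔎 X 𝔖 k).PY
  PYZ := (pieces 𝔎 X 𝔖 k).PYZ
  Pold := (pieces 𝔎 X 𝔖 k).Pold
  PoldIn := (pieces 𝔎 X 𝔖 k).PoldIn
  rem := (pieces 𝔎 X 𝔖 k).rem
  rem_nonneg := (pieces 𝔎 X 𝔖 k).rem_nonneg

/-- **(22)/(55) TRANSPORTS FROM THE UNPINNED TO THE PINNED TOWER**: `Bound55` for `piecesW` (seat p4's shape) gives `Bound55` for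
`pieces` — (41)_k through `SectB.TowerObjects.ineq41_pin_iff`, `ρ_{k+1}` through `pin_rho`, everything else verbatim. [cite: Balaban1985UV3, (55) p.269] -/
theorem bound55_pieces_of_unpinned (k : ℕ) (h : Bound55 (piecesW 𝔎 X 𝔖 k)) : Bound55 (pieces 𝔎 X 𝔖 k) := by
  intro h41 U
  have hb := h (((towerW 𝔎 X 𝔖).ineq41_pin_iff k).mp h41) U
  have hρ : (towerOf 𝔎 X 𝔖).ρ (k + 1) U = (towerW 𝔎 X 𝔖).toTowerRun.ρ (k + 1) U :=
    congrFun ((towerW 𝔎 X 𝔖).pin_rho (k + 1)) U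
  rw [hρ]
  exact hb

/-- The lower twin transports likewise ((47)_k through `ineq47_pin_iff`). [cite: Balaban1985UV3, (47) p.267 + p.272 L32–33] -/
theorem bound55Lower_pieces_of_unpinned (k : ℕ) (h : Bound55Lower (piecesW 𝔎 X 𝔖 k)) : Bound55Lower (pieces 𝔎 X 𝔖 k) := by
  intro h47 U
  have hb := h (((towerW 𝔎 X 𝔖).ineq47_pin_iff k).mp h47) U
  have hρ : (towerOf 𝔎 X 𝔖).ρ (k + 1) U = (towerW 𝔎 X 𝔖).toTowerRun.ρ (k + 1) U :=
    congrFun ((towerW 𝔎 X 𝔖).pin_rho (k + 1)) U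
  rw [hρ]
  exact hb

end Unpin

/-! ## §3 The bookkeeping step leaves at the lane's pieces: star count, Z-term booking, remainder booking -/

section StepBookkeeping

variable (𝔎 : LaneConsts L) {S : Scales L} {G : Type} [GaugeGroup G] [MeasurableSpace G] [HaarData G]
  {V : Type} [NormedAddCommGroup V] [NormedSpace ℂ V]
  (X : ExternalInputs S G) (𝔖 : ∀ k, StepSeries S G V (nblkOf S 𝔎.carrier k) k) (k : ℕ)

/-- **R-CUBE: the block carrier fits in the lattice** — `Nblk³ ≤ |T₁^{(k)}|` for the standard block count `nblkOf S K k = max 1 ⌊(sites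
per direction)/M₁⌋`, `k ≤ m + K` (seats p5/p6's `hblocks`, a THEOREM at the lane's input; `ScalesArithmetic.blocks_div_cube_le_sites`). [cite: Balaban1985UV3, (39) p.266] -/
theorem nblk_cube_le_sites (hk : k ≤ S.m + S.K) : ((nblkOf S 𝔎.carrier k : ℕ) : ℝ) ^ 3 ≤ S.sites k := by
  unfold nblkOf
  rcases le_total 1 (S.P.sitesPerDir k / 𝔎.carrier.M₁) with h | h
  · rw [max_eq_right h]
    exact blocks_div_cube_le_sites S k hk 𝔎.carrier.M₁
  · rw [max_eq_left h]
    have hL : (1 : ℝ) ≤ L := by exact_mod_cast S.hL.2.le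
    have h2 : (1 : ℝ) ≤ 2 * (L : ℝ) ^ (S.m + S.K - k) := by
      have := one_le_pow₀ (M₀ := ℝ) hL (n := S.m + S.K - k); linarith
    rw [sites_eq_card S k hk, card_site_eq]
    push_cast
    calc (1 : ℝ) ^ 3 = 1 := by norm_num
      _ ≤ (2 * (L : ℝ) ^ (S.m + S.K - k)) ^ 3 := one_le_pow₀ h2

/-- **Row C9 `starCount` AT THE LANE'S PIECES, `c₁ = 3`**: `0 ≤ |T₁^{(k)*}| − |B(Λ_{k+1})*| ≤ 3|Z_k|` for `k + 1 ≤ K` — the pieces book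
`starT := starCount univ`, `starB h := starCount (Λ_{k+1}(h))` and p1's `Zvol h = |Z_k(h)|` (`ZVol … (k+1) h k`), so
`StarCountRun3.starCount_leaf_run3` applies with every identification `rfl`. [cite: Balaban1985UV3, p.265 L8–9 + p.271 L13] -/
theorem starCount_pieces (hk : k + 1 ≤ S.K) : StarCount (pieces 𝔎 X 𝔖 k) 3 :=
  starCount_leaf_run3 (P := S.P) rfl 𝔎.F.M₁ (rcolOf S 𝔎.carrier) (by show k + 1 ≤ S.m + S.K; omega) rfl (pieces 𝔎 X 𝔖 k) rfl
    (fun _ => rfl) (fun _ => le_rfl)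

/-- **Row C13 `ztermSucc` AT THE LANE'S PIECES**: the booked coefficient `zcoefOf S K k = (Cz + Cv)g_k + C₅ + C₆ + (|log σ₀| + d(𝔤) log g_k⁻¹)·3`
IS the gathered constant of `StepLeaves.ztermSucc` (`c₁ = 3`), the history projection keeps the recorded `|Z_j|`, `j < k` (p1
`tower3_Zvol_proj`), and the pieces' `|Z_k|` is the tower's (`rfl`): seat p5's `Run3Zterm.ztermSucc_towerObjects`. [cite: Balaban1985UV3, (41) p.266 + p.271 L13] -/
theorem ztermSucc_pieces :
    ZtermSucc (pieces 𝔎 X 𝔖 k) ((𝔎.sc.Cz + 𝔎.sc.Cv) * (towerOf 𝔎 X 𝔖).g k + 𝔎.sc.C₅ + 𝔎.sc.C₆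
      + (|(pieces 𝔎 X 𝔖 k).logσ₀| + (pieces 𝔎 X 𝔖 k).dg * Real.log ((towerOf 𝔎 X 𝔖).g k)⁻¹) * 3) :=
  ztermSucc_towerObjects (inputOf 𝔎 X 𝔖).tower3 (pieces 𝔎 X 𝔖 k)
    (fun h j hj => (inputOf 𝔎 X 𝔖).tower3_Zvol_proj k h j hj) (fun _ => rfl) le_rfl

/-- **Row C14 `rmSucc` AT THE LANE'S PIECES**: the tower books `Rm k = Σ_{j<k} rcoef j·(L^jε)^{3+κ₀}|T₁^{(j)}|` literally ((41) p. 266,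
spine `SectB.TowerObjects.Rm`) with `rcoef j = rstar·g^{6+2κ₀}` (`rcoefOf`), and `rstar·g^{6+2κ₀}·(L^kε)^{3+κ₀}|T₁^{(k)}| =
rstar·(g_k²)^{3+κ₀}|T₁^{(k)}| = rstar·rem_k` (`ScalesArithmetic.gk_sq_rpow`): seat p6's `VacuumAndBooking.rmSucc_of_sum_booking` with
equality. [cite: Balaban1985UV3, (41) p.266] -/
theorem rmSucc_pieces :
    RmSucc (pieces 𝔎 X 𝔖 k) (max 𝔎.sc.C₁ 𝔎.sc.C₁' + 𝔎.sc.C₂ + 𝔎.sc.C₃ + 𝔎.sc.C₄) := by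
  refine VacuumAndBooking.rmSucc_of_sum_booking (pieces 𝔎 X 𝔖 k)
    (fun j => (inputOf 𝔎 X 𝔖).rcoef j * ((L : ℝ) ^ j * S.ε) ^ (3 + (inputOf 𝔎 X 𝔖).κ₀) * S.sites j) _ (fun _ => rfl) (le_of_eq ?_)
  show 𝔎.sc.rstar * ((S.gk k ^ 2) ^ (3 + 𝔎.F.κ₀) * S.sites k)
    = rcoefOf S 𝔎.carrier k * ((L : ℝ) ^ k * S.ε) ^ (3 + 𝔎.F.κ₀) * S.sites k
  rw [rcoefOf_carrier, gk_sq_rpow]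
  show 𝔎.sc.rstar * ((S.g ^ 2) ^ (3 + 𝔎.F.κ₀) * ((L : ℝ) ^ k * S.ε) ^ (3 + 𝔎.F.κ₀) * S.sites k)
    = 𝔎.sc.rstar * (S.g ^ 2) ^ (3 + 𝔎.F.κ₀) * ((L : ℝ) ^ k * S.ε) ^ (3 + 𝔎.F.κ₀) * S.sites k
  ring

end StepBookkeeping

end Summit.QuantumFields.Balaban3D.Proofs.Inputs

end
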